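import Summits.CriticalPhenomena.Ising3DConformalLimit.Theses.SubPtolemyInterlacing
import Literature.Probability.LatticeModels.CriticalUrsellFourSign
import Literature.Probability.LatticeModels.CriticalAxisRatioRegularity
import HarnessLib

/-!
# Line `Sketch` for the crux `SubPtolemyInterlacing.Interlacing` (stmt-CriticalPhenomena-15702) — stub `stub_lebowitzRegime`

The Lebowitz corner of the interlacing inequality: Lebowitz `S₄ ≤ P₁ + P₂ + P₃` (`criticalUrsellFour_nonpos`)
gives `S₄ P₂ ≤ P₁ P₃` whenever `2 P₂² ≤ (P₁ - P₂)(P₃ - P₂)` (pure algebra).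

Helper file of the line `Sketch` (lead skeleton `Cruxes/Interlacing/Lines/Sketch.lean`): proves the registered stub
`stub_lebowitzRegime` verbatim (name + signature). No definitions, no named facts, no sorry.
-/

noncomputable section

namespace Summit.CriticalPhenomena.Ising3DConformalLimit.Cruxes.Interlacing.Sketch

open Filter MeasureTheory
open scoped symmDiff Topology
open Literature.Probability.LatticeModels Literature.Probability.Percolation

/-- **Stub `stub_lebowitzRegime`** of the line `Sketch` (crux stmt-CriticalPhenomena-15702): The Lebowitz corner of the interlacing inequality: Lebowitz `S₄ ≤ P₁ + P₂ + P₃` (`criticalUrsellFour_nonpos`) gives `S₄ P₂ ≤ P₁ P₃` whenever `2 P₂² ≤ (P₁ - P₂)(P₃ - P₂)` (pure algebra). -/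
theorem stub_lebowitzRegime : ∀ a b c : ℕ,
    2 * (criticalCorr 3 2 ![((0 : ℕ) : ℤ) • (Pi.single 0 1 : Site 3), ((a + b : ℕ) : ℤ) • (Pi.single 0 1 : Site 3)] *
            criticalCorr 3 2 ![((a : ℕ) : ℤ) • (Pi.single 0 1 : Site 3), ((a + b + c : ℕ) : ℤ) • (Pi.single 0 1 : Site 3)]) ^ 2 ≤
        (criticalCorr 3 2 ![((0 : ℕ) : ℤ) • (Pi.single 0 1 : Site 3), ((a : ℕ) : ℤ) • (Pi.single 0 1 : Site 3)] *
            criticalCorr 3 2 ![((a + b : ℕ) : ℤ) • (Pi.single 0 1 : Site 3), ((a + b + c : ℕ) : ℤ) • (Pi.single 0 1 : Site 3)] -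
          criticalCorr 3 2 ![((0 : ℕ) : ℤ) • (Pi.single 0 1 : Site 3), ((a + b : ℕ) : ℤ) • (Pi.single 0 1 : Site 3)] *
            criticalCorr 3 2 ![((a : ℕ) : ℤ) • (Pi.single 0 1 : Site 3), ((a + b + c : ℕ) : ℤ) • (Pi.single 0 1 : Site 3)]) *
        (criticalCorr 3 2 ![((0 : ℕ) : ℤ) • (Pi.single 0 1 : Site 3), ((a + b + c : ℕ) : ℤ) • (Pi.single 0 1 : Site 3)] *
            criticalCorr 3 2 ![((a : ℕ) : ℤ) • (Pi.single 0 1 : Site 3), ((a + b : ℕ) : ℤ) • (Pi.single 0 1 : Site 3)] -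
          criticalCorr 3 2 ![((0 : ℕ) : ℤ) • (Pi.single 0 1 : Site 3), ((a + b : ℕ) : ℤ) • (Pi.single 0 1 : Site 3)] *
            criticalCorr 3 2 ![((a : ℕ) : ℤ) • (Pi.single 0 1 : Site 3), ((a + b + c : ℕ) : ℤ) • (Pi.single 0 1 : Site 3)]) →
      criticalCorr 3 4 ![((0 : ℕ) : ℤ) • (Pi.single 0 1 : Site 3), ((a : ℕ) : ℤ) • (Pi.single 0 1 : Site 3), ((a + b : ℕ) : ℤ) • (Pi.single 0 1 : Site 3),
          ((a + b + c : ℕ) : ℤ) • (Pi.single 0 1 : Site 3)] *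
          (criticalCorr 3 2 ![((0 : ℕ) : ℤ) • (Pi.single 0 1 : Site 3), ((a + b : ℕ) : ℤ) • (Pi.single 0 1 : Site 3)] *
            criticalCorr 3 2 ![((a : ℕ) : ℤ) • (Pi.single 0 1 : Site 3), ((a + b + c : ℕ) : ℤ) • (Pi.single 0 1 : Site 3)]) ≤
        criticalCorr 3 2 ![((0 : ℕ) : ℤ) • (Pi.single 0 1 : Site 3), ((a : ℕ) : ℤ) • (Pi.single 0 1 : Site 3)] *
            criticalCorr 3 2 ![((a + b : ℕ) : ℤ) • (Pi.single 0 1 : Site 3), ((a + b + c : ℕ) : ℤ) • (Pi.single 0 1 : Site 3)] *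
          (criticalCorr 3 2 ![((0 : ℕ) : ℤ) • (Pi.single 0 1 : Site 3), ((a + b + c : ℕ) : ℤ) • (Pi.single 0 1 : Site 3)] *
            criticalCorr 3 2 ![((a : ℕ) : ℤ) • (Pi.single 0 1 : Site 3), ((a + b : ℕ) : ℤ) • (Pi.single 0 1 : Site 3)]) := by
  intro a b c hyp
  -- name the four collinear points
  set x0 : Site 3 := ((0 : ℕ) : ℤ) • (Pi.single 0 1 : Site 3)
  set xa : Site 3 := ((a : ℕ) : ℤ) • (Pi.single 0 1 : Site 3)
  set xab : Site 3 := ((a + b : ℕ) : ℤ) • (Pi.single 0 1 : Site 3)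
  set xabc : Site 3 := ((a + b + c : ℕ) : ℤ) • (Pi.single 0 1 : Site 3)
  -- Lebowitz: `S₄ - (P₁ + P₂ + P₃) ≤ 0`
  have hleb := criticalUrsellFour_nonpos (d := 3) le_rfl ![x0, xa, xab, xabc]
  simp only [Matrix.cons_val_zero, Matrix.cons_val_one, Matrix.cons_val] at hleb
  -- Griffiths: `P₂ ≥ 0`
  have hP2nonneg : 0 ≤ criticalCorr 3 2 ![x0, xab] * criticalCorr 3 2 ![xa, xabc] :=
    mul_nonneg (criticalCorr_two_nonneg _ _) (criticalCorr_two_nonneg _ _)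
  have hprod := mul_le_mul_of_nonneg_right hleb hP2nonneg
  -- the seven real numbers, made opaque
  set S : ℝ := criticalCorr 3 4 ![x0, xa, xab, xabc]
  set A : ℝ := criticalCorr 3 2 ![x0, xa]
  set B : ℝ := criticalCorr 3 2 ![xab, xabc]
  set C : ℝ := criticalCorr 3 2 ![x0, xab]
  set D : ℝ := criticalCorr 3 2 ![xa, xabc]
  set E : ℝ := criticalCorr 3 2 ![x0, xabc]
  set F : ℝ := criticalCorr 3 2 ![xa, xab]
  nlinarith [hprod, hyp, hP2nonneg]

end Summit.CriticalPhenomena.Ising3DConformalLimit.Cruxes.Interlacing.Sketch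

end
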